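import Mathlib.Analysis.InnerProductSpace.PiL2
import Mathlib.Analysis.Normed.Operator.LinearIsometry
import Literature.MathematicalPhysics.StatisticalMechanics.MuGroundStateConfiguration
import Literature.MathematicalPhysics.StatisticalMechanics.BarlowStacking
import Literature.MathematicalPhysics.StatisticalMechanics.HaggStacking

/-!
# Crux `PeriodicWindows` (stmt-AtomisticToContinuum-3240), line `dense-laminar-hull` — stub P2

Stub `stub_windowsOfTemplateHullPoint` of the lead skeleton `PeriodicWindowsDenseLaminarHull`
(pure bookkeeping): if a rigid image `(fun p => B p + t₀) '' T` of a layered template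
`T = T(a, s, z)` (triangular layers of spacing `a` in hollow registry, Hägg word `s`, heights `z`)
is a point `Z` of the ROTATED HULL of a sequence `x` of finite configurations (`Z` is the local
two-way-matching limit, `BallMatch` on every ball about `0`, of `A j (x (σ j) ·) + τ j` along a
strictly increasing `σ`, `A j` linear isometry equivalences, `τ j` translations), then the
layered-windows clause holds along `x`: for every `(R, ε)`, frequently in `N`, a translate
`x N + t` is two-way `ε`-matched on the `R`-ball about `0` with a template `T(a, s, z)` carried by
a linear isometry.

Proof: given `M`, hull membership at radius `R + ‖t₀‖` and tolerance `ε` holds at some index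
`j ≥ M`; take `N = σ j ≥ j ≥ M` (`StrictMono.id_le`), the linear isometry `A' = (A j)⁻¹ ∘ B`, the
translation `t = (A j)⁻¹ (τ j - t₀)` and the same `(s, z)`.  The key identity
`dist (x N i + t) (A' p) = dist (A j (x N i) + τ j) (B p + t₀)` (apply the isometry `A j` to both
arguments) transports the two matching clauses of `BallMatch`; the radii are related by
`‖B p + t₀‖ ≤ ‖A' p‖ + ‖t₀‖` and `‖A j (x N i) + τ j‖ ≤ ‖x N i + t‖ + ‖t₀‖`.  Pattern of the landed
`PeriodicWindowsSketch.stub_hcpHullPointGivesWindows` (Step 1).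
-/

noncomputable section

namespace Summit.AtomisticToContinuum.Crystallization.Theorems.PeriodicWindowsDenseLaminarHull

open Literature.MathematicalPhysics.StatisticalMechanics Filter Metric

/-- STUB P2 (bookkeeping): if a rigid image `B '' T(a, s, z) + t₀` of a layered template lies in the
rotated hull of `x`, then the layered-windows clause of item 11778 holds along `x` with this `a`
(for `(R, ε)`: hull matching at radius `R + ‖t₀‖`, undo the linear isometry `A j`, translate by
`(A j)⁻¹ (τ j - t₀)`; the template is carried by the linear isometry `(A j)⁻¹ ∘ B`; `∃ᶠ N` from
`StrictMono σ`). -/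
theorem stub_windowsOfTemplateHullPoint : ∀ x : (N : ℕ) → (Fin N → EuclideanSpace ℝ (Fin 3)), ∀ a : ℝ,
    ∀ Z : Set (EuclideanSpace ℝ (Fin 3)),
    (∃ (σ : ℕ → ℕ) (τ : ℕ → EuclideanSpace ℝ (Fin 3))
        (A : ℕ → (EuclideanSpace ℝ (Fin 3) ≃ₗᵢ[ℝ] EuclideanSpace ℝ (Fin 3))),
      StrictMono σ ∧ ∀ R ε : ℝ, 0 < ε → ∀ᶠ j in Filter.atTop,
        BallMatch ε R 0 (Set.range fun i => A j (x (σ j) i) + τ j) Z) →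
    (∃ (B : EuclideanSpace ℝ (Fin 3) ≃ₗᵢ[ℝ] EuclideanSpace ℝ (Fin 3)) (t₀ : EuclideanSpace ℝ (Fin 3))
        (s : ℤ → ℤ) (z : ℤ → ℝ), IsHaggSeq s ∧
        (∀ m : ℤ, 39 / 50 * a ≤ z (m + 1) - z m ∧ z (m + 1) - z m ≤ 17 / 20 * a) ∧
        Z = (fun p => B p + t₀) '' {p | ∃ m i j : ℤ, p = ((i : ℝ) • triangularVec₁ a) +
          ((j : ℝ) • triangularVec₂ a) + ((haggLabel s m : ℝ) • barlowOffset a) + (z m • layerNormal 1)}) →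
    ∀ R ε : ℝ, 0 < ε → ∃ᶠ N in Filter.atTop,
      ∃ (A : EuclideanSpace ℝ (Fin 3) →ₗᵢ[ℝ] EuclideanSpace ℝ (Fin 3)) (t : EuclideanSpace ℝ (Fin 3)) (s : ℤ → ℤ)
        (z : ℤ → ℝ), IsHaggSeq s ∧ (∀ m : ℤ, 39 / 50 * a ≤ z (m + 1) - z m ∧ z (m + 1) - z m ≤ 17 / 20 * a) ∧
        let S : Set (EuclideanSpace ℝ (Fin 3)) := {p | ∃ m i j : ℤ, p = A (((i : ℝ) • triangularVec₁ a) +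
          ((j : ℝ) • triangularVec₂ a) + ((haggLabel s m : ℝ) • barlowOffset a) + (z m • layerNormal 1))};
        (∀ p ∈ S, ‖p‖ ≤ R → ∃ i : Fin N, dist (x N i + t) p ≤ ε) ∧
        (∀ i : Fin N, ‖x N i + t‖ ≤ R → ∃ p ∈ S, dist (x N i + t) p ≤ ε) := by
  intro x a Z hhull htempl R ε hε
  obtain ⟨σ, τ, A, hσ, hlim⟩ := hhull
  obtain ⟨B, t₀, s, z, hs, hz, hZ⟩ := htempl
  rw [Filter.frequently_atTop]
  intro M
  -- hull membership at radius `R + ‖t₀‖`, tolerance `ε`, at an index `j ≥ M`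
  obtain ⟨j, hMj, hBM⟩ := ((eventually_ge_atTop M).and (hlim (R + ‖t₀‖) ε hε)).exists
  -- the linear isometry `A' = (A j)⁻¹ ∘ B` and the translation `t = (A j)⁻¹ (τ j - t₀)`
  obtain ⟨A', hA'⟩ : ∃ A' : EuclideanSpace ℝ (Fin 3) →ₗᵢ[ℝ] EuclideanSpace ℝ (Fin 3),
      ∀ p, A j (A' p) = B p :=
    ⟨(B.trans (A j).symm).toLinearIsometry, fun p => by simp⟩
  obtain ⟨t, ht⟩ : ∃ t : EuclideanSpace ℝ (Fin 3), A j t = τ j - t₀ :=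
    ⟨(A j).symm (τ j - t₀), by simp⟩
  -- key identity: apply the isometry `A j` to both arguments
  have hkey : ∀ (i : Fin (σ j)) (p : EuclideanSpace ℝ (Fin 3)),
      dist (x (σ j) i + t) (A' p) = dist (A j (x (σ j) i) + τ j) (B p + t₀) := by
    intro i p
    rw [← (A j).dist_map, map_add, hA', ht, dist_eq_norm, dist_eq_norm]
    congr 1
    abel
  -- template points of the `R`-ball are near particles
  have hmatch₁ : ∀ q : EuclideanSpace ℝ (Fin 3), B q + t₀ ∈ Z → ‖A' q‖ ≤ R →
      ∃ i : Fin (σ j), dist (x (σ j) i + t) (A' q) ≤ ε := by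
    intro q hqZ hqR
    rw [A'.norm_map] at hqR
    have hnorm : dist (B q + t₀) 0 ≤ R + ‖t₀‖ := by
      rw [dist_zero_right]
      calc ‖B q + t₀‖ ≤ ‖B q‖ + ‖t₀‖ := norm_add_le _ _
        _ = ‖q‖ + ‖t₀‖ := by rw [B.norm_map]
        _ ≤ R + ‖t₀‖ := by linarith
    obtain ⟨_, ⟨i, rfl⟩, hi⟩ := hBM.1 (B q + t₀) hqZ hnorm
    refine ⟨i, ?_⟩
    rw [hkey]
    exact hi
  -- particles of the `R`-ball are near points of `Z`
  have hmatch₂ : ∀ i : Fin (σ j), ‖x (σ j) i + t‖ ≤ R →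
      ∃ w ∈ Z, dist (A j (x (σ j) i) + τ j) w ≤ ε := by
    intro i hi
    refine hBM.2 (A j (x (σ j) i) + τ j) ⟨i, rfl⟩ ?_
    have h1 : A j (x (σ j) i) + τ j = A j (x (σ j) i + t) + t₀ := by
      rw [map_add, ht]
      abel
    rw [dist_zero_right, h1]
    calc ‖A j (x (σ j) i + t) + t₀‖ ≤ ‖A j (x (σ j) i + t)‖ + ‖t₀‖ := norm_add_le _ _
      _ = ‖x (σ j) i + t‖ + ‖t₀‖ := by rw [(A j).norm_map]
      _ ≤ R + ‖t₀‖ := by linarith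
  refine ⟨σ j, hMj.trans (hσ.id_le j), A', t, s, z, hs, hz, ?_, ?_⟩
  · -- every template point of the window is near a particle
    rintro p ⟨m, k, l, hp⟩ hpR
    rw [hp] at hpR ⊢
    refine hmatch₁ _ ?_ hpR
    rw [hZ]
    exact ⟨_, ⟨m, k, l, rfl⟩, rfl⟩
  · -- every particle of the window is near a template point
    intro i hi
    obtain ⟨w, hw, hiw⟩ := hmatch₂ i hi
    rw [hZ] at hw
    obtain ⟨q, ⟨m, k, l, hq⟩, rfl⟩ := hw
    refine ⟨A' q, ⟨m, k, l, by rw [hq]⟩, ?_⟩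
    rw [hkey]
    exact hiw

end Summit.AtomisticToContinuum.Crystallization.Theorems.PeriodicWindowsDenseLaminarHull

end
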